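/-
Copyright: the b2b-balaban cell (near-miss cell 7), T⁴-continuum fan-out, lineage t4-ne7b-p2 (node U5c RENEWAL member).
Released under the licence of the surrounding project.
-/
import Summits.QuantumFields.BalabanUV.T4Continuum.Support.RenewalGroveSum

/-!
# The tilted per-slot bound: the renewal forest also controls the pending mass weighted by the REMAINING LIFE

Summits-side support leaf of the T⁴-continuum cell (rung (B)+1 on a FINITE torus only; NOT infinite volume, NOT the
mass gap, NOT the Clay statement; NOT a proof of the spine estimate NE7b).  Lineage `t4-ne7b-p2` (generation 23),
node U5c, RENEWAL route; amendment N5⁺ of the ROUND-2 skeleton `t4/skeletons/NE7b-t4-ne7b-p2.md` (v1.7).  [folklore]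
finite sums and real arithmetic over the lineage's OWN carriers (`T4PersistenceRenewal.ForestWitness ∕ ForestDom`,
`T4PersistenceGrove.Grove ∕ Script ∕ horizon ∕ booking`, `RenewalGroveSum`); nothing is quoted from print, nothing
printed is asserted, no `[cite:]` tag; none of the cell's conditionals ((B), BetaPertH) occurs.

WHY (the located amendment, v1.7 of the skeleton).  On the renewal route a pending structure absorbs, at a join, a
younger-or-equal partner `Y` whose own record is resummed (leaf N5).  The merged tree reaches
`max (reach X) (reach Y) + W(join)`; the ledger increment of the absorption edge,
`E c + lag ≤ E (parent c) + booking c` (`T4PersistenceGrove.Script.increment`), therefore needs the booking to cover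
`W(join) + (reach Y − reach X)⁺ ≤ W(join) + (reach Y − t)` — the partner's REMAINING LIFE beyond the join step `t`,
tilted at the banking rate `z₁`.  So the induction on the cutoff must carry, for every slot and cutoff `m`, a bound on the
TILTED pending mass `Σ_{c pending at m} ω c·z₁^(reach c − (j + Ah) )` (`Ah = m − j`), not only on `Σ ω c`.  This file
shows the forest supplies it AT NO EXTRA COST: in `T4PersistenceRenewal.ForestWitness` the actual weight is only asked
to satisfy `w c ≤ term (last c)·v c` with `term s = z₁^{−(Ah − s)}`, `v c = ω c·z₁^(E c)`, and for a pending component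
`E c − (Ah − last c)` IS the remaining life; the plain bound used `w = ω ≤ term·v`, the tilted one uses `w = term·v`.

WHAT.  §1 `forestDom_of_banked_sum_tilted`: `RenewalGroveSum.forestDom_of_banked_sum` with the weight clause relaxed to
`w c ≤ ω c·z₁^(E c − (Ah − last c))`.  §2 `forestDom_of_grove_sum_tilted`: the ledger form, weight clause
`w c ≤ ω c·z₁^(mreach (grove c) − (j + Ah))`.  §3 `forestDom_of_grove_product_tilted` ∕ `sum_tilted_le_of_grove_product`:
the absolute-majorant form — under EXACTLY the hypotheses of `RenewalGroveSum.sum_le_of_grove_product`,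
`Σ_{c ∈ Pend} ω c·z₁^(mreach (grove c) − (j + Ah)) ≤ (B₀·D∕η)·(z⁻¹)^Ah`, `D = 1∕(1 − z₁⁻¹z)`; and `sum_le_sum_tilted`:
the plain mass is below the tilted one (`1 ≤ z₁`).  §4 the decided two-node toy of `RenewalGroveSum` §4, tilted (the
pending child reaches `5 > 0 + 4`, remaining life `1`, tilted mass `4∕65536 ≤ 1∕6`).

HONEST DEPENDENCY (cell): continuum YM on T⁴ ⇐ BetaPertH ∧ nine spine estimates (0/9 proved); BetaPertH ⇐ (D1) ∧ (D4)
∧ CAP+tail.  This file changes none of it.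
-/

open Finset
open Literature.MathematicalPhysics.QuantumFieldTheory.Balaban1983to89
open T4PersistenceDictionary T4PersistenceRenewal T4PersistenceGrove
open Summit.QuantumFields.BalabanUV.T4Continuum.RenewalGroveSum

namespace Summit.QuantumFields.BalabanUV.T4Continuum.RenewalTiltedForest

noncomputable section

/-! ## §1 The banked constructor with the weight clause relaxed to the remaining life -/

section Banked

variable {ι : Type*} [DecidableEq ι]

/-- **BANKED PRICING, COMBINED CATALOGUE, TILTED WEIGHTS ⇒ PER-FIBRE EVENT DOMINATION.**  As
`RenewalGroveSum.forestDom_of_banked_sum` (forest `Φ`, weight majorant `ω ≥ 0`, effective remaining horizon `E`, root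
profile `b` with budget `b s·z^s ≤ B₀·a₀`, run tilt `1 ≤ z < z₁`, slack `ε·(z∕z₁)∕(1 − z∕z₁) ≤ 1 − η`, pending class alive
across the horizon, ONE per-parent banked sum) EXCEPT that the actual weights are only asked to satisfy
`w c ≤ ω c·z₁^(E c − (Ah − last c))` on `Pend` — the majorant TILTED BY THE REMAINING LIFE beyond the horizon.
Conclusion `ForestDom Pend w a₀ Ah z η B₀ (1∕(1 − z₁⁻¹·z))`. [folklore] -/
theorem forestDom_of_banked_sum_tilted {Pend : Finset ι} {w : ι → ℝ} {a₀ : ℝ} {Ah : ℕ}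
    {z z₁ η B₀ ε : ℝ} (Φ : EventForest ι) (ω : ι → ℝ) (E : ι → ℕ) (b : ℕ → ℝ)
    (hz : 1 ≤ z) (hzz : z < z₁) (hε : 0 ≤ ε)
    (pend_sub : Pend ⊆ Φ.Cmp) (last_le : ∀ c ∈ Pend, Φ.last c ≤ Ah) (ω_nonneg : ∀ c ∈ Φ.Cmp, 0 ≤ ω c)
    (hslack : ε * ((z / z₁) / (1 - z / z₁)) ≤ 1 - η)
    (root_budget : ∀ s, b s * z ^ s ≤ B₀ * a₀)
    (root : ∀ s, ∑ c ∈ Φ.Cmp with (Φ.last c = s ∧ c ∈ Φ.roots), ω c * z₁ ^ (E c) ≤ b s)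
    (hsum : ∀ P ∈ Φ.Cmp, ∀ s, Φ.last P < s →
      ∑ c ∈ Φ.Cmp with (Φ.last c = s ∧ c ∉ Φ.roots ∧ Φ.parent c = P),
        ω c * z₁ ^ (E c) * z₁ ^ (s - Φ.last P) ≤ ε * (ω P * z₁ ^ (E P)))
    (alive : ∀ c ∈ Pend, Ah - Φ.last c ≤ E c)
    (weight_le : ∀ c ∈ Pend, w c ≤ ω c * z₁ ^ (E c - (Ah - Φ.last c))) :
    ForestDom Pend w a₀ Ah z η B₀ (1 / (1 - z₁⁻¹ * z)) := by
  have hz0 : 0 < z := lt_of_lt_of_le one_pos hz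
  have hz₁0 : 0 < z₁ := hz0.trans hzz
  have hσ : 0 ≤ z₁⁻¹ := inv_nonneg.2 hz₁0.le
  -- the banked potential
  let v : ι → ℝ := fun c => ω c * z₁ ^ (E c)
  have v_nonneg : ∀ c ∈ Φ.Cmp, 0 ≤ v c := fun c hc => mul_nonneg (ω_nonneg c hc) (pow_nonneg hz₁0.le _)
  have child : ∀ P ∈ Φ.Cmp, ∀ s, Φ.last P < s →
      ∑ c ∈ Φ.Cmp with (Φ.last c = s ∧ c ∉ Φ.roots ∧ Φ.parent c = P), v c ≤ ε * z₁⁻¹ ^ (s - Φ.last P) * v P := by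
    intro P hP s hs
    have hpow : 0 < z₁ ^ (s - Φ.last P) := pow_pos hz₁0 _
    have h := hsum P hP s hs
    have h' : (∑ c ∈ Φ.Cmp with (Φ.last c = s ∧ c ∉ Φ.roots ∧ Φ.parent c = P), v c) * z₁ ^ (s - Φ.last P) ≤
        ε * v P := by
      rw [Finset.sum_mul]; exact h
    rw [← le_div_iff₀ hpow] at h'
    refine h'.trans (le_of_eq ?_)
    rw [inv_pow, div_eq_mul_inv]; ring
  let X : ForestWitness Pend w a₀ Ah z η B₀ :=
    { forest := Φ
      v := v
      F := fun _ ℓ => ε * z₁⁻¹ ^ ℓ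
      b := b
      term := fun s => z₁⁻¹ ^ (Ah - s)
      pend_sub := pend_sub
      last_le := last_le
      v_nonneg := v_nonneg
      F_nonneg := fun _ ℓ => mul_nonneg hε (pow_nonneg hσ _)
      gen := fun s => (banked_column_le_geom hz0.le hz₁0 hzz hε s).trans hslack
      root_budget := root_budget
      root := root
      child := child
      term_nonneg := fun s => pow_nonneg hσ _
      weight_le := by
        intro c hc
        show w c ≤ z₁⁻¹ ^ (Ah - Φ.last c) * (ω c * z₁ ^ (E c))
        obtain ⟨d, hd⟩ := Nat.exists_eq_add_of_le (alive c hc)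
        have hdE : E c - (Ah - Φ.last c) = d := by omega
        have hsplit : z₁⁻¹ ^ (Ah - Φ.last c) * (ω c * z₁ ^ (E c)) = ω c * z₁ ^ d := by
          rw [hd, pow_add, inv_pow]
          field_simp
        rw [hsplit]
        have h := weight_le c hc
        rwa [hdE] at h }
  have hσz : z₁⁻¹ * z < 1 := by
    rw [inv_mul_lt_iff₀ hz₁0]; simpa using hzz
  exact X.dom_of_pairing (W := fun s => Ah - s) hσ hz hσz fun s _ => by
    show z₁⁻¹ ^ (Ah - s) ≤ if Ah - s ≤ Ah - s then z₁⁻¹ ^ (Ah - s) else 0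
    rw [if_pos le_rfl]

end Banked

/-! ## §2 The ledger form, tilted by the reach beyond the cutoff -/

section Ledger

variable {ι : Type*} [DecidableEq ι] {ε : Type*}

/-- **THE COMBINED-CATALOGUE LEDGER CONSTRUCTOR, TILTED.**  As `RenewalGroveSum.forestDom_of_grove_sum` (LEDGER
`hroot`∕`hstep`∕`hpend`, RAW PRICES `hraw₀`∕`hraw`, ROOT MASS, per-parent catalogue `hcat`, SLACK) EXCEPT that the actual
weights are only asked to satisfy `w c ≤ ω c·z₁^(mreach W (grove c) − (j + Ah))` on `Pend`: the majorant tilted by the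
grove's REACH BEYOND THE CUTOFF `j + Ah`.  Conclusion `ForestDom Pend w a₀ Ah z η B₀ (1∕(1 − z₁⁻¹·z))`. [folklore] -/
theorem forestDom_of_grove_sum_tilted {Pend : Finset ι} {w : ι → ℝ} {a₀ : ℝ} {Ah : ℕ}
    {z z₁ η B₀ εc : ℝ} (Φ : EventForest ι) (ω pr : ι → ℝ)
    (W : ε → ℕ) (j : ℕ) (grove : ι → Grove ε) (ev : ι → ε) (tail : ι → List (ε × ℕ))
    (hz : 1 ≤ z) (hzz : z < z₁) (hε : 0 ≤ εc) (ha₀ : 0 ≤ a₀) (hB₀ : 0 ≤ B₀)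
    (pend_sub : Pend ⊆ Φ.Cmp) (hCmp : ∀ c ∈ Φ.Cmp, Φ.last c ≤ Ah) (ω_nonneg : ∀ c ∈ Φ.Cmp, 0 ≤ ω c)
    (hslack : εc * ((z / z₁) / (1 - z / z₁)) ≤ 1 - η)
    (hroot : ∀ c ∈ Φ.Cmp, c ∈ Φ.roots →
      Φ.last c = 0 ∧ Script W ({Gen.born (ev c) j} : Grove ε) (tail c) (grove c))
    (hraw₀ : ∀ c ∈ Φ.Cmp, c ∈ Φ.roots → ω c ≤ pr c * a₀)
    (hpair₀ : ∑ c ∈ Φ.Cmp with c ∈ Φ.roots, pr c * z₁ ^ (booking W ev tail c) ≤ B₀)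
    (hstep : ∀ c ∈ Φ.Cmp, c ∉ Φ.roots → Script W (grove (Φ.parent c)) ((ev c, j + Φ.last c) :: tail c) (grove c))
    (hraw : ∀ c ∈ Φ.Cmp, c ∉ Φ.roots → ω c ≤ pr c * ω (Φ.parent c))
    (hcat : ∀ P ∈ Φ.Cmp, ∀ s, s ≤ Ah → Φ.last P < s →
      ∑ c ∈ Φ.Cmp with (Φ.last c = s ∧ c ∉ Φ.roots ∧ Φ.parent c = P), pr c * z₁ ^ (booking W ev tail c) ≤ εc)
    (hpend : ∀ c ∈ Pend, j + Ah < mreach W (grove c))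
    (weight_le : ∀ c ∈ Pend, w c ≤ ω c * z₁ ^ (mreach W (grove c) - (j + Ah))) :
    ForestDom Pend w a₀ Ah z η B₀ (1 / (1 - z₁⁻¹ * z)) := by
  have hz₁ : 1 ≤ z₁ := hz.trans hzz.le
  have hz₁0 : 0 < z₁ := lt_of_lt_of_le one_pos hz₁
  -- the root profile: everything at age 0
  let b : ℕ → ℝ := fun s => if s = 0 then B₀ * a₀ else 0
  refine forestDom_of_banked_sum_tilted Φ ω (horizon W j Φ grove) b hz hzz hε pend_sub
    (fun c hc => hCmp c (pend_sub hc)) ω_nonneg hslack ?_ ?_ ?_ (fun c hc => horizon_alive (hpend c hc)) ?_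
  · -- root budget
    intro s
    by_cases hs : s = 0
    · subst hs; simp [b]
    · simp only [b, if_neg hs, zero_mul]; exact mul_nonneg hB₀ ha₀
  · -- banked root bound from the raw root price and the root pairing mass
    intro s
    by_cases hs : s = 0
    · subst hs
      simp only [b, if_pos rfl]
      have hfilter : (Φ.Cmp.filter fun c => Φ.last c = 0 ∧ c ∈ Φ.roots) = Φ.Cmp.filter fun c => c ∈ Φ.roots := by
        refine Finset.filter_congr fun c hc => ⟨fun h => h.2, fun h => ⟨(hroot c hc h).1, h⟩⟩
      rw [hfilter]
      calc ∑ c ∈ Φ.Cmp with c ∈ Φ.roots, ω c * z₁ ^ (horizon W j Φ grove c)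
          ≤ ∑ c ∈ Φ.Cmp with c ∈ Φ.roots, pr c * z₁ ^ (booking W ev tail c) * a₀ := by
            refine Finset.sum_le_sum fun c hc => ?_
            obtain ⟨hcC, hcr⟩ := Finset.mem_filter.1 hc
            obtain ⟨hl0, hscr⟩ := hroot c hcC hcr
            refine banked_root_of_raw hz₁ (ω_nonneg c hcC) (hraw₀ c hcC hcr) ?_
            have h := hscr.root_horizon_le
            simp only [horizon, booking, hl0, Nat.add_zero]
            exact h
        _ = (∑ c ∈ Φ.Cmp with c ∈ Φ.roots, pr c * z₁ ^ (booking W ev tail c)) * a₀ := by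
            rw [Finset.sum_mul]
        _ ≤ B₀ * a₀ := mul_le_mul_of_nonneg_right hpair₀ ha₀
    · simp only [b, if_neg hs]
      have hempty : (Φ.Cmp.filter fun c => Φ.last c = s ∧ c ∈ Φ.roots) = ∅ := by
        refine Finset.filter_eq_empty_iff.2 fun c hc h => hs ?_
        rw [← h.1, (hroot c hc h.2).1]
      rw [hempty, Finset.sum_empty]
  · -- the banked per-parent sum from the raw prices, the own bookings and the ledger increments
    intro P hP s hs
    have hvP : 0 ≤ ω P * z₁ ^ (horizon W j Φ grove P) := mul_nonneg (ω_nonneg P hP) (pow_nonneg hz₁0.le _)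
    by_cases hsA : s ≤ Ah
    · calc ∑ c ∈ Φ.Cmp with (Φ.last c = s ∧ c ∉ Φ.roots ∧ Φ.parent c = P),
              ω c * z₁ ^ (horizon W j Φ grove c) * z₁ ^ (s - Φ.last P)
            ≤ ∑ c ∈ Φ.Cmp with (Φ.last c = s ∧ c ∉ Φ.roots ∧ Φ.parent c = P),
              pr c * z₁ ^ (booking W ev tail c) * (ω P * z₁ ^ (horizon W j Φ grove P)) := by
              refine Finset.sum_le_sum fun c hc => ?_
              obtain ⟨hcC, hls, hr, hpar⟩ := Finset.mem_filter.1 hc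
              have hinc := horizon_increment (W := W) (j := j) (grove := grove) (ev := ev) (tail := tail)
                hcC hr (hstep c hcC hr)
              rw [hpar, hls] at hinc
              have h := banked_price_of_increment hz₁ (ω_nonneg c hcC) (ω_nonneg P hP)
                (by simpa [hpar] using hraw c hcC hr) (le_refl (pr c * z₁ ^ (booking W ev tail c))) hinc
              exact h
          _ = (∑ c ∈ Φ.Cmp with (Φ.last c = s ∧ c ∉ Φ.roots ∧ Φ.parent c = P),
              pr c * z₁ ^ (booking W ev tail c)) * (ω P * z₁ ^ (horizon W j Φ grove P)) := by
              rw [Finset.sum_mul]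
          _ ≤ εc * (ω P * z₁ ^ (horizon W j Φ grove P)) :=
              mul_le_mul_of_nonneg_right (hcat P hP s hsA hs) hvP
    · -- beyond the horizon there are no components at all
      have hempty : (Φ.Cmp.filter fun c => Φ.last c = s ∧ c ∉ Φ.roots ∧ Φ.parent c = P) = ∅ := by
        refine Finset.filter_eq_empty_iff.2 fun c hc h => hsA ?_
        rw [← h.1]; exact hCmp c hc
      rw [hempty, Finset.sum_empty]
      exact mul_nonneg hε hvP
  · -- the tilted weight clause: for a pending component the reach beyond the cutoff IS `horizon − (Ah − last)`
    intro c hc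
    have hlast := hCmp c (pend_sub hc)
    have hp := hpend c hc
    have hE : horizon W j Φ grove c - (Ah - Φ.last c) = mreach W (grove c) - (j + Ah) := by
      unfold horizon; omega
    rw [hE]
    exact weight_le c hc

end Ledger

/-! ## §3 The absolute-majorant form: the tilted per-slot bound under the hypotheses of `sum_le_of_grove_product` -/

section Product

variable {ι : Type*} [DecidableEq ι] {ε : Type*}

/-- **THE PRODUCT MAJORANT, TILTED.**  Under the hypotheses of `RenewalGroveSum.forestDom_of_grove_product` (weight =
product of the edge prices; ledger; root mass; combined catalogue; slack), the forest dominates the pending mass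
WEIGHTED BY THE REACH BEYOND THE CUTOFF: `ForestDom Pend (fun c => ω c·z₁^(mreach W (grove c) − (j + Ah))) 1 Ah z η B₀
(1∕(1 − z₁⁻¹·z))`. [folklore] -/
theorem forestDom_of_grove_product_tilted {Pend : Finset ι} {Ah : ℕ}
    {z z₁ η B₀ εc : ℝ} (Φ : EventForest ι) (ω pr : ι → ℝ)
    (W : ε → ℕ) (j : ℕ) (grove : ι → Grove ε) (ev : ι → ε) (tail : ι → List (ε × ℕ))
    (hz : 1 ≤ z) (hzz : z < z₁) (hε : 0 ≤ εc) (hB₀ : 0 ≤ B₀)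
    (pend_sub : Pend ⊆ Φ.Cmp) (hCmp : ∀ c ∈ Φ.Cmp, Φ.last c ≤ Ah) (ω_nonneg : ∀ c ∈ Φ.Cmp, 0 ≤ ω c)
    (hslack : εc * ((z / z₁) / (1 - z / z₁)) ≤ 1 - η)
    (hroot : ∀ c ∈ Φ.Cmp, c ∈ Φ.roots →
      Φ.last c = 0 ∧ Script W ({Gen.born (ev c) j} : Grove ε) (tail c) (grove c))
    (hωroot : ∀ c ∈ Φ.Cmp, c ∈ Φ.roots → ω c = pr c)
    (hωstep : ∀ c ∈ Φ.Cmp, c ∉ Φ.roots → ω c = pr c * ω (Φ.parent c))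
    (hpair₀ : ∑ c ∈ Φ.Cmp with c ∈ Φ.roots, pr c * z₁ ^ (booking W ev tail c) ≤ B₀)
    (hstep : ∀ c ∈ Φ.Cmp, c ∉ Φ.roots → Script W (grove (Φ.parent c)) ((ev c, j + Φ.last c) :: tail c) (grove c))
    (hcat : ∀ P ∈ Φ.Cmp, ∀ s, s ≤ Ah → Φ.last P < s →
      ∑ c ∈ Φ.Cmp with (Φ.last c = s ∧ c ∉ Φ.roots ∧ Φ.parent c = P), pr c * z₁ ^ (booking W ev tail c) ≤ εc)
    (hpend : ∀ c ∈ Pend, j + Ah < mreach W (grove c)) :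
    ForestDom Pend (fun c => ω c * z₁ ^ (mreach W (grove c) - (j + Ah))) 1 Ah z η B₀ (1 / (1 - z₁⁻¹ * z)) :=
  forestDom_of_grove_sum_tilted Φ ω pr W j grove ev tail hz hzz hε zero_le_one hB₀ pend_sub hCmp ω_nonneg hslack hroot
    (fun c hc hr => by rw [hωroot c hc hr, mul_one]) hpair₀ hstep (fun c hc hr => (hωstep c hc hr).le) hcat hpend
    (fun _ _ => le_rfl)

/-- **THE TILTED PER-SLOT BOUND OF THE RENEWAL ROUTE**: under the hypotheses of
`RenewalGroveSum.sum_le_of_grove_product` (with `0 < η`), the pending product-majorant mass of the slot WEIGHTED BY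
`z₁^(reach beyond the cutoff)` obeys the same bound as the plain mass:
`Σ_{c ∈ Pend} ω c·z₁^(mreach W (grove c) − (j + Ah)) ≤ (B₀·(1∕(1 − z₁⁻¹z))∕η)·(z⁻¹)^Ah`.  This is the quantity the
absorption edges of LATER cutoffs consume (the absorbed partner's remaining life is booked at the banking rate), so it is
the shape the induction on the cutoff carries (skeleton v1.7, N5⁺). [folklore] -/
theorem sum_tilted_le_of_grove_product {Pend : Finset ι} {Ah : ℕ}
    {z z₁ η B₀ εc : ℝ} (Φ : EventForest ι) (ω pr : ι → ℝ)
    (W : ε → ℕ) (j : ℕ) (grove : ι → Grove ε) (ev : ι → ε) (tail : ι → List (ε × ℕ))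
    (hz : 1 ≤ z) (hzz : z < z₁) (hε : 0 ≤ εc) (hη : 0 < η) (hB₀ : 0 ≤ B₀)
    (pend_sub : Pend ⊆ Φ.Cmp) (hCmp : ∀ c ∈ Φ.Cmp, Φ.last c ≤ Ah) (ω_nonneg : ∀ c ∈ Φ.Cmp, 0 ≤ ω c)
    (hslack : εc * ((z / z₁) / (1 - z / z₁)) ≤ 1 - η)
    (hroot : ∀ c ∈ Φ.Cmp, c ∈ Φ.roots →
      Φ.last c = 0 ∧ Script W ({Gen.born (ev c) j} : Grove ε) (tail c) (grove c))
    (hωroot : ∀ c ∈ Φ.Cmp, c ∈ Φ.roots → ω c = pr c)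
    (hωstep : ∀ c ∈ Φ.Cmp, c ∉ Φ.roots → ω c = pr c * ω (Φ.parent c))
    (hpair₀ : ∑ c ∈ Φ.Cmp with c ∈ Φ.roots, pr c * z₁ ^ (booking W ev tail c) ≤ B₀)
    (hstep : ∀ c ∈ Φ.Cmp, c ∉ Φ.roots → Script W (grove (Φ.parent c)) ((ev c, j + Φ.last c) :: tail c) (grove c))
    (hcat : ∀ P ∈ Φ.Cmp, ∀ s, s ≤ Ah → Φ.last P < s →
      ∑ c ∈ Φ.Cmp with (Φ.last c = s ∧ c ∉ Φ.roots ∧ Φ.parent c = P), pr c * z₁ ^ (booking W ev tail c) ≤ εc)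
    (hpend : ∀ c ∈ Pend, j + Ah < mreach W (grove c)) :
    ∑ c ∈ Pend, ω c * z₁ ^ (mreach W (grove c) - (j + Ah)) ≤ B₀ * (1 / (1 - z₁⁻¹ * z)) / η * (z⁻¹) ^ Ah * 1 :=
  (forestDom_of_grove_product_tilted Φ ω pr W j grove ev tail hz hzz hε hB₀ pend_sub hCmp ω_nonneg hslack hroot hωroot
    hωstep hpair₀ hstep hcat hpend).sum_le (lt_of_lt_of_le one_pos hz) hη hB₀ zero_le_one

omit [DecidableEq ι] in
/-- The plain pending mass is below the tilted one (`1 ≤ z₁`, `ω ≥ 0` on `Pend`). [folklore] -/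
theorem sum_le_sum_tilted {Pend : Finset ι} {Ah j : ℕ} {z₁ : ℝ} (ω : ι → ℝ) (W : ε → ℕ) (grove : ι → Grove ε)
    (hz₁ : 1 ≤ z₁) (ω_nonneg : ∀ c ∈ Pend, 0 ≤ ω c) :
    ∑ c ∈ Pend, ω c ≤ ∑ c ∈ Pend, ω c * z₁ ^ (mreach W (grove c) - (j + Ah)) :=
  Finset.sum_le_sum fun c hc => le_mul_of_one_le_right (ω_nonneg c hc) (one_le_pow₀ hz₁)

end Product

/-! ## §4 The decided two-node toy of `RenewalGroveSum` §4, tilted -/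

section Toy

open Gen

/-- **EVERY HYPOTHESIS AT ONCE**, tilted: on the sanity slot of `RenewalGroveSum.forestDom_toy` (components `Bool`,
root `false` = `{born 0 0}`, child `true` = the birth of constituent `1` at age `1`, grove `g₁` reaching `5`; prices
`1∕64`, `1∕1024`, PRODUCT weight; windows `W₀ = (3, 4, 2)`, horizon `Ah = 4`, tilts `z = 2 < z₁ = 4`, `εc = 1∕4`,
`η = 3∕4`, `B₀ = 1`) the pending child's reach beyond the cutoff is `5 − (0 + 4) = 1`, and the tilted pending mass is
`(1∕1024)·(1∕64)·4 = 1∕16384 ≤ (1·(1∕(1 − 4⁻¹·2))∕(3∕4))·(2⁻¹)^4·1 = 1∕6`. [folklore] -/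
theorem sum_tilted_toy :
    ∑ c ∈ ({true} : Finset Bool), (fun c : Bool => if c then (1 : ℝ) / 1024 * (1 / 64) else 1 / 64) c *
        (4 : ℝ) ^ (mreach W₀ ((fun c : Bool => if c then g₁ else g₀) c) - (0 + 4)) ≤
      1 * (1 / (1 - (4 : ℝ)⁻¹ * 2)) / (3 / 4) * ((2 : ℝ)⁻¹) ^ 4 * 1 := by
  -- the forest, groves, undone events and edge prices of the toy
  let Φ : EventForest Bool :=
    { Cmp := univ
      roots := {false}
      last := fun c => if c then 1 else 0
      parent := fun _ => false
      parent_mem := fun _ _ _ => mem_univ _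
      last_lt := fun c _ hr => by
        cases c
        · exact absurd (mem_singleton_self false) hr
        · simp }
  let ev : Bool → ℕ := fun c => if c then 1 else 0
  let pr : Bool → ℝ := fun c => if c then 1 / 1024 else 1 / 64
  have hCmp : ∀ c, c ∈ Φ.Cmp := fun c => mem_univ c
  have hroots : ∀ c, c ∈ Φ.roots ↔ c = false := fun c => by simp [Φ]
  refine sum_tilted_le_of_grove_product (εc := 1 / 4) Φ _ pr W₀ 0 _ ev (fun _ => [])
    (by norm_num) (by norm_num) (by norm_num) (by norm_num) (by norm_num) (fun c _ => hCmp c) ?_ ?_ (by norm_num)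
    ?_ ?_ ?_ ?_ ?_ ?_ ?_
  · -- ages ≤ 4
    intro c _; cases c <;> simp [Φ]
  · intro c _; cases c <;> norm_num
  · -- roots: the bare birth, no tail
    intro c _ hr
    rw [hroots] at hr
    subst hr
    exact ⟨rfl, by simpa [ev, g₀] using Script.nil ({Gen.born 0 0} : Grove ℕ)⟩
  · intro c _ hr
    rw [hroots] at hr
    subst hr; rfl
  · intro c _ hr
    rw [hroots] at hr
    cases c
    · exact absurd rfl hr
    · simp [pr, Φ]
  · -- root pairing mass: `(1/64)·4^3 = 1`
    have hf : (Φ.Cmp.filter fun c => c ∈ Φ.roots) = {false} := by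
      ext c; cases c <;> simp [Φ]
    rw [hf, sum_singleton]
    simp [pr, booking, ev, W₀]
    norm_num
  · -- the one edge is the ledger's birth step `step₁ : Step W₀ g₀ 1 1 g₁`
    intro c _ hr
    rw [hroots] at hr
    cases c
    · exact absurd rfl hr
    · simpa [Φ, ev] using Script.single step₁
  · -- the combined catalogue: only the parent `false` at age `1` has a child, which books `W₀ 1 = 4`
    intro P _ s _ _
    have hsub : (Φ.Cmp.filter fun c => Φ.last c = s ∧ c ∉ Φ.roots ∧ Φ.parent c = P) ⊆ {true} := by
      intro c hc
      cases c
      · simp [Φ] at hc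
      · exact mem_singleton_self _
    calc ∑ c ∈ Φ.Cmp with (Φ.last c = s ∧ c ∉ Φ.roots ∧ Φ.parent c = P), pr c * (4 : ℝ) ^ (booking W₀ ev (fun _ => []) c)
        ≤ ∑ c ∈ ({true} : Finset Bool), pr c * (4 : ℝ) ^ (booking W₀ ev (fun _ => []) c) :=
          sum_le_sum_of_subset_of_nonneg hsub fun c _ _ => by
            cases c <;> simp [pr]
      _ ≤ 1 / 4 := by simp [pr, booking, ev, W₀]; norm_num
  · -- pending: the child's grove reaches `5 > 0 + 4`
    intro c hc
    rw [mem_singleton] at hc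
    subst hc
    simp [g₁, W₀]

/-- the numbers of the tilted toy, decided: reach beyond the cutoff `5 − 4 = 1`, tilted mass `4∕65536 = 1∕16384 ≤ 1∕6` -/
example : (5 : ℕ) - (0 + 4) = 1 ∧ (1 : ℚ) / 1024 * (1 / 64) * 4 ^ 1 = 1 / 16384 ∧
    (1 : ℚ) / 16384 ≤ 1 * (1 / (1 - 1 / 4 * 2)) / (3 / 4) * (1 / 2) ^ 4 * 1 := by
  norm_num

end Toy

end

end Summit.QuantumFields.BalabanUV.T4Continuum.RenewalTiltedForest
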